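import Summits.BirchSwinnertonDyer.Rank1Residual.Additive.GordRankOneKatoCertificateThreeBSD
import HarnessLib

/-!
# T-O7c-anom: the ANOMALOUS (G-ord) rank-one rows — the honest form of the certificate-literal iff is a
# TRICHOTOMY `BSD(E,p) ⟺ ord_p q + ord_p Reg_p(E,Dh) + ord_p ℓ = 1` with Delbourgo's factor
# `ℓ ∈ {1, p, p²}` (cell `b2b-bsdres`, team n1011, seat p01 GEN 2; NEW SMALL ROW T-O7c-anom dealt by the
# lead GEN 6 R5-33: "the honest ANOMALOUS (G-ord) rank-1 form of the CERT literal iff via the rider's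
# 'ℓ ∣ p²' factor (typed trichotomy or the located reason none exists); r3's loop matrix names these
# 204/541 rows as the one remaining ℚ-side hole"; sibling of additive-p2's
# `GordRankOneKatoCertificateBSD.lean` and n1011-p12's `GordRankOneKatoCertificateThreeBSD.lean`, whose
# identity lemmas are consumed BY NAME — no new currency)

HONEST FRAMING (cell `b2b-bsdres`, run/shared/lean/b2b/bsd-rank1-residual/, verbatim in every
file): prove what is provable now; shrink each hard class to its core with data; no claim beyond
stated classes. Research routes; census output = EVIDENCE / conjecture items, never a Literature
fact; RESIDUAL-MAP marks change only by signed lines. §I O7 stays OPEN; X3♯(G-ord) / X4♯(G-ord) stay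
CONSTRUCTION-SHAPED; nothing is booked; no label changes. COVERAGE (stated first, referee 1
proviso): the (G-ord) defect-2 rows (`e_E(p) = 2`) of analytic rank `1` carrying additive-p2's
ONE-NUMBER unit certificate `BranchUnitCertificateAt W p` (the Néron-normalised branch series
`ϖ·B_{(p−1)/2}` has constant term `0` and a UNIT linear coefficient for every admissible datum), BOTH
parities; X4♯ = `ρ̄_{E,p}` onto (Kato 17.4 (3) half-eigen reading `hK`, published) or X3♯ = `E[p]`
reducible (Wuthrich 2014 Thm. 16 `hWu`, published); `p ≥ 5` (`E` non-CM is NOT needed) resp. `p = 3`;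
`Dh` ANY height datum with Delbourgo's (B)-clauses; `L'(E,1) = q·Ω_E·Reg_∞(E)`. **NO non-anomalous
hypothesis** — that is the point of the file. NO definition, NO Literature fact, NO `_holds`; theorems
only.

## What and why

On these rows additive-p2 / p12 proved `BSD(E,p) ⟺ ord_p q + ord_p Reg_p(E,Dh) = 1` UNDER
`ReductionNonAnomalous W p` (Delbourgo's `ℓ_p = 1`). Their identity lemmas
(`ClassX4Gord.schneider_and_padicVal_identity_rankOne_of_katoHalf_of_cert`, `ClassX3Gord.…_of_wuthrichHalf_
of_cert`, `…_identity_three_…`) are in fact anomalous-agnostic: they return Schneider and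
`∃ ℓ ∣ p², (ReductionNonAnomalous → ℓ = 1) ∧ ord_p #Ш(E) + ord_p Reg_p + ord_p ∏c + ord_p ℓ = 1 + 2·ord_p #tors`,
`ℓ` being the factor of Delbourgo's Theorem (B) AS TRANSCRIBED (`LeadingTermClauses`: "`ℓ ∣ p²`, `= 1`
off the anomalous rows" — deliberately WEAKER THAN PRINT, see that file's module docstring and the
flag `Del02-ThmB-ellp-anomalous`: print has `ℓ = ℓ_p(E)`, `= p` on anomalous rows under the literal
reading, which the cell's data do not support). Feeding `v := ord_p Reg_p + ord_p ℓ` to additive-p2's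
cell-agnostic `bsdp_iff_padicValRat_add_eq_one` gives, with NO `hna`:

* §1 `ClassX4Gord.exists_ell_bsdp_iff_padicVal_rankOne_of_katoHalf_of_cert` (+ X3 twin, + `p = 3`
  twins): `∃ ℓ ∣ p²`, `= 1` if non-anomalous, with the identity AND
  **`BSD(E,p) ⟺ ord_p q + ord_p Reg_p(E,Dh) + ord_p ℓ = 1`**. (`ord_p ℓ` is DETERMINED by the identity,
  so "the" `ℓ` is canonical a posteriori.)
* §2 TRICHOTOMY: `BSD(E,p) ⟹ ord_p q + ord_p Reg_p(E,Dh) ∈ {1, 0, −1}` (`ℓ ∈ {1, p, p²}`).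
* §3 the JOINT reading: if `ord_p q + ord_p Reg_p(E,Dh) = 1` (`hv` — exactly what the typed branch
  `p`-adic Gross–Zagier gives on unit-certified rows (additive-p2 §3, p17 (e), p12 at `3`); a consequence
  of OUR conjecture, entering as a HYPOTHESIS, never a fact) — then
  **`BSD(E,p) ⟺` the (B)-identity holds with TRIVIAL `ℓ`-factor** (`ord_p #Ш + ord_p Reg_p + ord_p ∏c =
  1 + 2·ord_p #tors`). So on an anomalous certified row the typed `p`-adic GZ and `BSD(E,p)` hold
  TOGETHER iff Delbourgo's factor is trivial there: were the literal reading `ℓ_p = p` correct on such a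
  row, they could not both hold — the kernel form of the flag; nothing is booked either way.
LOCATED REASON no `ℓ`-free literal iff is stated: `ℓ` is bound inside clause 3 of `LeadingTermClauses`
and no tree object computes Delbourgo's `ℓ_p(E)` on anomalous rows; the trichotomy is the honest
maximum until the literature flag is ruled.

References: [Delbourgo2002] Thm. (B) (p. 40) with p. 39 (`ℓ_p(E)`, `⟨,⟩_{p,ℚ}`), p. 69;
[Kato2004Asterisque] Thm. 17.4 (3); [Wuthrich2014] Thm. 16; [Miller2011LMS] Def. 1.1;
[MazurTateTeitelbaum1986Invent] §I.13–I.14.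
-/

noncomputable section

open scoped Classical MatrixGroups ModularForm NumberField

namespace Summit.BirchSwinnertonDyer.Rank1Residual.Additive

open CongruenceSubgroup WeierstrassCurve NumberField Literature.NumberTheory.EllipticCurves
  Literature.NumberTheory.EllipticCurves.ModularForms
  Literature.NumberTheory.EllipticCurves.Rank1Residual
  Literature.NumberTheory.EllipticCurves.Rank1Residual.Typed
  Literature.NumberTheory.EllipticCurves.Delbourgo2002
  Literature.NumberTheory.GaloisRepresentations Summit.BirchSwinnertonDyer.Rank1Residual.AdditivePotMult
  IsDedekindDomain

variable {W : WeierstrassCurve ℚ} [W.IsElliptic] [W.IsGloballyMinimal] {p : ℕ} [hp : Fact p.Prime]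

/-! ### §0 Cell-agnostic bookkeeping -/

omit [W.IsGloballyMinimal] in
/-- **Bookkeeping (cell-agnostic): the `ℓ`-shifted criterion.** If `ord_{s=1} L(E,s) ≤ 1` (GZK),
`L^{(r)}(E,1)/r! = q·Ω_E·Reg_∞` with `q ≠ 0`, and `ord_p #Ш(E) + v + ord_p ∏c + ord_p ℓ = 1 + 2·ord_p #tors`
(meant: `v = ord_p Reg_p(E,Dh)`, `ℓ` Delbourgo's factor), then `BSD(E,p) ⟺ ord_p q + v + ord_p ℓ = 1`.
additive-p2's `bsdp_iff_padicValRat_add_eq_one` at `v + ord_p ℓ`. [cite: Miller2011LMS, Def. 1.1] -/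
theorem bsdp_iff_padicValRat_add_add_eq_one (hGZK : rank_eq_analyticRank_of_analyticRank_le_one)
    (hr : W.analyticRank ≤ 1) {q : ℚ} (hq0 : q ≠ 0)
    (hLq : W.leadingLCoeff = (q : ℂ) * (W.realPeriodRat : ℂ) * (W.regulator : ℂ)) {v : ℤ} {ℓ : ℕ}
    (hid : (padicValNat p W.shaOrder : ℤ) + v + padicValNat p W.tamagawaProduct + padicValNat p ℓ =
      1 + 2 * padicValNat p W.torsionOrder) :
    BSDp W p ↔ padicValRat p q + v + padicValNat p ℓ = 1 := by
  have hid' : (padicValNat p W.shaOrder : ℤ) + (v + padicValNat p ℓ) + padicValNat p W.tamagawaProduct =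
      1 + 2 * padicValNat p W.torsionOrder := by linarith
  rw [bsdp_iff_padicValRat_add_eq_one (W := W) (p := p) hGZK hr hq0 hLq hid', add_assoc]

/-! ### §1 The `ℓ`-trichotomy iff on unit-certified (G-ord) rank-one rows — NO non-anomalous hypothesis -/

/-- **X4♯(G-ord) ∩ `I₀*` ∩ {`ρ̄_{E,p}` onto}, `p ≥ 5`, `e_E(p) = 2`, `r_an = 1`, unit certificate,
ANOMALOUS ALLOWED: for every (B)-datum `Dh` and `L'(E,1) = q·Ω_E·Reg_∞`, there is `ℓ ∣ p²` — Delbourgo's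
factor as transcribed, `= 1` if `ReductionNonAnomalous W p` — with the identity
`ord_p #Ш(E) + ord_p Reg_p(E,Dh) + ord_p ∏c + ord_p ℓ = 1 + 2·ord_p #tors` AND
`BSD(E,p) ⟺ ord_p q + ord_p Reg_p(E,Dh) + ord_p ℓ = 1`.** On non-anomalous rows this is additive-p2's
`ClassX4Gord.bsdp_iff_padicVal_rankOne_of_katoHalf_of_cert` (`ℓ = 1`). [cite: Delbourgo2002, Theorem (B) (p. 40)]
[cite: Kato2004Asterisque, Thm. 17.4 (3) (p. 273)] [cite: Miller2011LMS, Def. 1.1] -/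
theorem ClassX4Gord.exists_ell_bsdp_iff_padicVal_rankOne_of_katoHalf_of_cert
    (hK : Wuthrich2014.kato_halfEigenCharIdeal_dvd_cyclotomicPrime_of_surjective)
    (hmodD : nonempty_modularParametrizationData)
    (hGZK : rank_eq_analyticRank_of_analyticRank_le_one) (hmod : hasEntireLFunction_rat)
    (hX : ClassX4Gord W p) (hp5 : 5 ≤ p) (he : semistabilityIndex W p = 2) (hsurj : Surj W p)
    (hr : W.analyticRank = 1) (hcert : BranchUnitCertificateAt W p)
    {Dh : PAdicHeightData W p} (hB : LeadingTermClauses W p Dh)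
    {q : ℚ} (hLq : W.leadingLCoeff = (q : ℂ) * (W.realPeriodRat : ℂ) * (W.regulator : ℂ)) :
    ∃ ℓ : ℕ, ℓ ∣ p ^ 2 ∧ (ReductionNonAnomalous W p → ℓ = 1) ∧
      (padicValNat p W.shaOrder : ℤ) + (padicRegulator Dh).valuation +
          padicValNat p W.tamagawaProduct + padicValNat p ℓ = 1 + 2 * padicValNat p W.torsionOrder ∧
      (BSDp W p ↔ padicValRat p q + (padicRegulator Dh).valuation + padicValNat p ℓ = 1) := by
  obtain ⟨-, ℓ, hℓp, hℓ1, hid⟩ :=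
    hX.schneider_and_padicVal_identity_rankOne_of_katoHalf_of_cert hK hmodD hGZK hp5 he hsurj hr hcert hB
  have hq0 : q ≠ 0 := by
    rintro rfl
    rw [Rat.cast_zero, zero_mul, zero_mul] at hLq
    exact W.leadingLCoeff_ne_zero_holds (hmod W) hLq
  exact ⟨ℓ, hℓp, hℓ1, hid, bsdp_iff_padicValRat_add_add_eq_one (W := W) (p := p) hGZK (by rw [hr]) hq0
    hLq hid⟩

/-- **X3♯(G-ord) ∩ `I₀*` (reducible `E[p]`), `p ≥ 5`, `e_E(p) = 2`, `r_an = 1`, unit certificate,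
ANOMALOUS ALLOWED: the same `ℓ`-trichotomy iff from Wuthrich's divisibility.**
[cite: Delbourgo2002, Theorem (B) (p. 40)] [cite: Wuthrich2014, Thm. 16 (p. 397)] [cite: Miller2011LMS, Def. 1.1] -/
theorem ClassX3Gord.exists_ell_bsdp_iff_padicVal_rankOne_of_wuthrichHalf_of_cert
    (hWu : Wuthrich2014.thm16_halfEigenCharIdeal_dvd_cyclotomicPrime)
    (hmodD : nonempty_modularParametrizationData)
    (hGZK : rank_eq_analyticRank_of_analyticRank_le_one) (hmod : hasEntireLFunction_rat)
    (hX : ClassX3Gord W p) (hp5 : 5 ≤ p) (he : semistabilityIndex W p = 2)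
    (hr : W.analyticRank = 1) (hcert : BranchUnitCertificateAt W p)
    {Dh : PAdicHeightData W p} (hB : LeadingTermClauses W p Dh)
    {q : ℚ} (hLq : W.leadingLCoeff = (q : ℂ) * (W.realPeriodRat : ℂ) * (W.regulator : ℂ)) :
    ∃ ℓ : ℕ, ℓ ∣ p ^ 2 ∧ (ReductionNonAnomalous W p → ℓ = 1) ∧
      (padicValNat p W.shaOrder : ℤ) + (padicRegulator Dh).valuation +
          padicValNat p W.tamagawaProduct + padicValNat p ℓ = 1 + 2 * padicValNat p W.torsionOrder ∧
      (BSDp W p ↔ padicValRat p q + (padicRegulator Dh).valuation + padicValNat p ℓ = 1) := by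
  obtain ⟨-, ℓ, hℓp, hℓ1, hid⟩ :=
    hX.schneider_and_padicVal_identity_rankOne_of_wuthrichHalf_of_cert hWu hmodD hGZK hp5 he hr hcert hB
  have hq0 : q ≠ 0 := by
    rintro rfl
    rw [Rat.cast_zero, zero_mul, zero_mul] at hLq
    exact W.leadingLCoeff_ne_zero_holds (hmod W) hLq
  exact ⟨ℓ, hℓp, hℓ1, hid, bsdp_iff_padicValRat_add_add_eq_one (W := W) (p := p) hGZK (by rw [hr]) hq0
    hLq hid⟩

/-- **`p = 3` twin on X4♯(G-ord)@3 ∩ {`ρ̄_{E,3}` onto}** (over n1011-p12's identity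
`ClassX4Gord.schneider_and_padicVal_identity_three_of_katoHalf_of_cert`; `e = 2` automatic at `3`):
`∃ ℓ ∣ 9`, identity, and `BSD(E,3) ⟺ ord₃ q + ord₃ Reg₃(E,Dh) + ord₃ ℓ = 1` — ANOMALOUS ALLOWED.
[cite: Delbourgo2002, Theorem (B) (p. 40)] [cite: Kato2004Asterisque, Thm. 17.4 (3) (p. 273)]
[cite: Miller2011LMS, Def. 1.1] -/
theorem ClassX4Gord.exists_ell_bsdp_three_iff_padicVal_rankOne_of_katoHalf_of_cert
    [Fact (Nat.Prime 3)] {W : WeierstrassCurve ℚ} [W.IsElliptic] [W.IsGloballyMinimal]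
    (hK : Wuthrich2014.kato_halfEigenCharIdeal_dvd_cyclotomicPrime_of_surjective)
    (hmodD : nonempty_modularParametrizationData)
    (hGZK : rank_eq_analyticRank_of_analyticRank_le_one) (hmod : hasEntireLFunction_rat)
    (hX : ClassX4Gord W 3) (hsurj : Surj W 3) (hr : W.analyticRank = 1)
    (hcert : BranchUnitCertificateAt W 3) {Dh : PAdicHeightData W 3} (hB : LeadingTermClauses W 3 Dh)
    {q : ℚ} (hLq : W.leadingLCoeff = (q : ℂ) * (W.realPeriodRat : ℂ) * (W.regulator : ℂ)) :
    ∃ ℓ : ℕ, ℓ ∣ 3 ^ 2 ∧ (ReductionNonAnomalous W 3 → ℓ = 1) ∧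
      (padicValNat 3 W.shaOrder : ℤ) + (padicRegulator Dh).valuation +
          padicValNat 3 W.tamagawaProduct + padicValNat 3 ℓ = 1 + 2 * padicValNat 3 W.torsionOrder ∧
      (BSDp W 3 ↔ padicValRat 3 q + (padicRegulator Dh).valuation + padicValNat 3 ℓ = 1) := by
  obtain ⟨-, ℓ, hℓp, hℓ1, hid⟩ :=
    hX.schneider_and_padicVal_identity_three_of_katoHalf_of_cert hK hmodD hGZK hsurj hr hcert hB
  have hq0 : q ≠ 0 := by
    rintro rfl
    rw [Rat.cast_zero, zero_mul, zero_mul] at hLq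
    exact W.leadingLCoeff_ne_zero_holds (hmod W) hLq
  exact ⟨ℓ, hℓp, hℓ1, hid, bsdp_iff_padicValRat_add_add_eq_one (W := W) (p := 3) hGZK (by rw [hr]) hq0
    hLq hid⟩

/-- **`p = 3` twin on X3♯(G-ord)@3** (reducible `E[3]`; Wuthrich; p12's
`ClassX3Gord.schneider_and_padicVal_identity_three_of_wuthrichHalf_of_cert`): ANOMALOUS ALLOWED.
[cite: Delbourgo2002, Theorem (B) (p. 40)] [cite: Wuthrich2014, Thm. 16 (p. 397)] [cite: Miller2011LMS, Def. 1.1] -/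
theorem ClassX3Gord.exists_ell_bsdp_three_iff_padicVal_rankOne_of_wuthrichHalf_of_cert
    [Fact (Nat.Prime 3)] {W : WeierstrassCurve ℚ} [W.IsElliptic] [W.IsGloballyMinimal]
    (hWu : Wuthrich2014.thm16_halfEigenCharIdeal_dvd_cyclotomicPrime)
    (hmodD : nonempty_modularParametrizationData)
    (hGZK : rank_eq_analyticRank_of_analyticRank_le_one) (hmod : hasEntireLFunction_rat)
    (hX : ClassX3Gord W 3) (hr : W.analyticRank = 1)
    (hcert : BranchUnitCertificateAt W 3) {Dh : PAdicHeightData W 3} (hB : LeadingTermClauses W 3 Dh)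
    {q : ℚ} (hLq : W.leadingLCoeff = (q : ℂ) * (W.realPeriodRat : ℂ) * (W.regulator : ℂ)) :
    ∃ ℓ : ℕ, ℓ ∣ 3 ^ 2 ∧ (ReductionNonAnomalous W 3 → ℓ = 1) ∧
      (padicValNat 3 W.shaOrder : ℤ) + (padicRegulator Dh).valuation +
          padicValNat 3 W.tamagawaProduct + padicValNat 3 ℓ = 1 + 2 * padicValNat 3 W.torsionOrder ∧
      (BSDp W 3 ↔ padicValRat 3 q + (padicRegulator Dh).valuation + padicValNat 3 ℓ = 1) := by
  obtain ⟨-, ℓ, hℓp, hℓ1, hid⟩ :=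
    hX.schneider_and_padicVal_identity_three_of_wuthrichHalf_of_cert hWu hmodD hGZK hr hcert hB
  have hq0 : q ≠ 0 := by
    rintro rfl
    rw [Rat.cast_zero, zero_mul, zero_mul] at hLq
    exact W.leadingLCoeff_ne_zero_holds (hmod W) hLq
  exact ⟨ℓ, hℓp, hℓ1, hid, bsdp_iff_padicValRat_add_add_eq_one (W := W) (p := 3) hGZK (by rw [hr]) hq0
    hLq hid⟩

/-! ### §2 The TRICHOTOMY: `BSD(E,p) ⟹ ord_p q + ord_p Reg_p(E,Dh) ∈ {1, 0, −1}` -/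

/-- **TRICHOTOMY on X4♯(G-ord) unit-certified rank-one rows, `p ≥ 5`, ANOMALOUS ALLOWED:** `BSD(E,p)`
forces `ord_p q + ord_p Reg_p(E,Dh) = 1 − ord_p ℓ ∈ {1, 0, −1}` (the three cases `ℓ = 1, p, p²`; the
non-anomalous rows sit in the first). [cite: Delbourgo2002, Theorem (B) (p. 40)]
[cite: Kato2004Asterisque, Thm. 17.4 (3) (p. 273)] [cite: Miller2011LMS, Def. 1.1] -/
theorem ClassX4Gord.padicValRat_add_valuation_trichotomy_of_bsdp_of_katoHalf_of_cert
    (hK : Wuthrich2014.kato_halfEigenCharIdeal_dvd_cyclotomicPrime_of_surjective)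
    (hmodD : nonempty_modularParametrizationData)
    (hGZK : rank_eq_analyticRank_of_analyticRank_le_one) (hmod : hasEntireLFunction_rat)
    (hX : ClassX4Gord W p) (hp5 : 5 ≤ p) (he : semistabilityIndex W p = 2) (hsurj : Surj W p)
    (hr : W.analyticRank = 1) (hcert : BranchUnitCertificateAt W p)
    {Dh : PAdicHeightData W p} (hB : LeadingTermClauses W p Dh)
    {q : ℚ} (hLq : W.leadingLCoeff = (q : ℂ) * (W.realPeriodRat : ℂ) * (W.regulator : ℂ))
    (hbsd : BSDp W p) :
    padicValRat p q + (padicRegulator Dh).valuation = 1 ∨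
      padicValRat p q + (padicRegulator Dh).valuation = 0 ∨
      padicValRat p q + (padicRegulator Dh).valuation = -1 := by
  obtain ⟨ℓ, hℓp, -, -, hiff⟩ := hX.exists_ell_bsdp_iff_padicVal_rankOne_of_katoHalf_of_cert hK hmodD hGZK
    hmod hp5 he hsurj hr hcert hB hLq
  have h := hiff.mp hbsd
  have hle : padicValNat p ℓ ≤ 2 := padicValNat_le_two_of_dvd_sq p hℓp
  interval_cases hv : padicValNat p ℓ
  · left; push_cast [hv] at h; linarith
  · right; left; push_cast [hv] at h; linarith
  · right; right; push_cast [hv] at h; linarith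

/-- **TRICHOTOMY on X3♯(G-ord) unit-certified rank-one rows, `p ≥ 5`, ANOMALOUS ALLOWED.**
[cite: Delbourgo2002, Theorem (B) (p. 40)] [cite: Wuthrich2014, Thm. 16 (p. 397)] [cite: Miller2011LMS, Def. 1.1] -/
theorem ClassX3Gord.padicValRat_add_valuation_trichotomy_of_bsdp_of_wuthrichHalf_of_cert
    (hWu : Wuthrich2014.thm16_halfEigenCharIdeal_dvd_cyclotomicPrime)
    (hmodD : nonempty_modularParametrizationData)
    (hGZK : rank_eq_analyticRank_of_analyticRank_le_one) (hmod : hasEntireLFunction_rat)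
    (hX : ClassX3Gord W p) (hp5 : 5 ≤ p) (he : semistabilityIndex W p = 2)
    (hr : W.analyticRank = 1) (hcert : BranchUnitCertificateAt W p)
    {Dh : PAdicHeightData W p} (hB : LeadingTermClauses W p Dh)
    {q : ℚ} (hLq : W.leadingLCoeff = (q : ℂ) * (W.realPeriodRat : ℂ) * (W.regulator : ℂ))
    (hbsd : BSDp W p) :
    padicValRat p q + (padicRegulator Dh).valuation = 1 ∨
      padicValRat p q + (padicRegulator Dh).valuation = 0 ∨
      padicValRat p q + (padicRegulator Dh).valuation = -1 := by
  obtain ⟨ℓ, hℓp, -, -, hiff⟩ := hX.exists_ell_bsdp_iff_padicVal_rankOne_of_wuthrichHalf_of_cert hWu hmodD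
    hGZK hmod hp5 he hr hcert hB hLq
  have h := hiff.mp hbsd
  have hle : padicValNat p ℓ ≤ 2 := padicValNat_le_two_of_dvd_sq p hℓp
  interval_cases hv : padicValNat p ℓ
  · left; push_cast [hv] at h; linarith
  · right; left; push_cast [hv] at h; linarith
  · right; right; push_cast [hv] at h; linarith

/-! ### §3 The JOINT reading: given `ord_p q + ord_p Reg_p = 1` (what the typed `p`-adic GZ gives), `BSD(E,p)` ⟺ the (B)-identity with trivial `ℓ` -/

/-- **JOINT READING on X4♯(G-ord) unit-certified rank-one rows, `p ≥ 5`, ANOMALOUS ALLOWED.** If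
`ord_p q + ord_p Reg_p(E,Dh) = 1` (`hv` — on these rows exactly the valuation content of the typed branch
`p`-adic Gross–Zagier, additive-p2's `…branchPAdicGrossZagierAt_iff_bsdp_of_katoHalf_of_cert` §3 / p17's
odd twin; HONESTY (referee 1 ACK-1 proviso): `hv` is a CONSEQUENCE OF OUR CONJECTURE — the typed
`BranchPAdicGrossZagier[Odd]At`, OPEN at rank one — and enters as a HYPOTHESIS, never as a fact), then
**`BSD(E,p) ⟺ ord_p #Ш(E) + ord_p Reg_p(E,Dh) + ord_p ∏c = 1 + 2·ord_p #E(ℚ)_tors`** —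
Delbourgo's (B)-identity with TRIVIAL `ℓ`-factor. So typed pGZ ∧ `BSD(E,p)` hold together on an anomalous
certified row iff the factor is trivial there (kernel form of the flag `Del02-ThmB-ellp-anomalous`;
nothing booked). [cite: Delbourgo2002, Theorem (B) (p. 40) and p. 39 (ℓ_p)]
[cite: Kato2004Asterisque, Thm. 17.4 (3) (p. 273)] [cite: Miller2011LMS, Def. 1.1] -/
theorem ClassX4Gord.bsdp_iff_identity_ell_one_of_katoHalf_of_cert_of_padicVal
    (hK : Wuthrich2014.kato_halfEigenCharIdeal_dvd_cyclotomicPrime_of_surjective)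
    (hmodD : nonempty_modularParametrizationData)
    (hGZK : rank_eq_analyticRank_of_analyticRank_le_one) (hmod : hasEntireLFunction_rat)
    (hX : ClassX4Gord W p) (hp5 : 5 ≤ p) (he : semistabilityIndex W p = 2) (hsurj : Surj W p)
    (hr : W.analyticRank = 1) (hcert : BranchUnitCertificateAt W p)
    {Dh : PAdicHeightData W p} (hB : LeadingTermClauses W p Dh)
    {q : ℚ} (hLq : W.leadingLCoeff = (q : ℂ) * (W.realPeriodRat : ℂ) * (W.regulator : ℂ))
    (hv : padicValRat p q + (padicRegulator Dh).valuation = 1) :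
    BSDp W p ↔
      (padicValNat p W.shaOrder : ℤ) + (padicRegulator Dh).valuation + padicValNat p W.tamagawaProduct =
        1 + 2 * padicValNat p W.torsionOrder := by
  obtain ⟨ℓ, -, -, hid, hiff⟩ := hX.exists_ell_bsdp_iff_padicVal_rankOne_of_katoHalf_of_cert hK hmodD hGZK
    hmod hp5 he hsurj hr hcert hB hLq
  rw [hiff]
  constructor
  · intro h
    have h0 : (padicValNat p ℓ : ℤ) = 0 := by linarith
    linarith
  · intro h
    have h0 : (padicValNat p ℓ : ℤ) = 0 := by linarith
    linarith

/-- **JOINT READING on X3♯(G-ord) unit-certified rank-one rows, `p ≥ 5`, ANOMALOUS ALLOWED** (`hv` = the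
typed `p`-adic GZ's valuation content: a consequence of OUR conjecture, a HYPOTHESIS here, never a fact).
[cite: Delbourgo2002, Theorem (B) (p. 40)] [cite: Wuthrich2014, Thm. 16 (p. 397)] [cite: Miller2011LMS, Def. 1.1] -/
theorem ClassX3Gord.bsdp_iff_identity_ell_one_of_wuthrichHalf_of_cert_of_padicVal
    (hWu : Wuthrich2014.thm16_halfEigenCharIdeal_dvd_cyclotomicPrime)
    (hmodD : nonempty_modularParametrizationData)
    (hGZK : rank_eq_analyticRank_of_analyticRank_le_one) (hmod : hasEntireLFunction_rat)
    (hX : ClassX3Gord W p) (hp5 : 5 ≤ p) (he : semistabilityIndex W p = 2)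
    (hr : W.analyticRank = 1) (hcert : BranchUnitCertificateAt W p)
    {Dh : PAdicHeightData W p} (hB : LeadingTermClauses W p Dh)
    {q : ℚ} (hLq : W.leadingLCoeff = (q : ℂ) * (W.realPeriodRat : ℂ) * (W.regulator : ℂ))
    (hv : padicValRat p q + (padicRegulator Dh).valuation = 1) :
    BSDp W p ↔
      (padicValNat p W.shaOrder : ℤ) + (padicRegulator Dh).valuation + padicValNat p W.tamagawaProduct =
        1 + 2 * padicValNat p W.torsionOrder := by
  obtain ⟨ℓ, -, -, hid, hiff⟩ := hX.exists_ell_bsdp_iff_padicVal_rankOne_of_wuthrichHalf_of_cert hWu hmodD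
    hGZK hmod hp5 he hr hcert hB hLq
  rw [hiff]
  constructor
  · intro h
    have h0 : (padicValNat p ℓ : ℤ) = 0 := by linarith
    linarith
  · intro h
    have h0 : (padicValNat p ℓ : ℤ) = 0 := by linarith
    linarith

end Summit.BirchSwinnertonDyer.Rank1Residual.Additive

end
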